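import Summits.HodgeConjecture.CorCM.GaloisOddPrimeShapesQuaternionBad
import Summits.HodgeConjecture.CorCM.GaloisQuaternionCyclicLiftPredicate
import HarnessLib

/-!
# THE SHAPES Q× AND QK ARE BAD FOR `p ∈ {17, 19, 37, 43}` TOO: GOOD Galois CM fields of degree `2ⁿ·p` (`n ≥ 5`),
# `p ∈ {3, 5, 7, 11, 13, 17, 19, 37, 43}`, have shape C(r) or Dic

COR-CM (cell `pub-hodgecm2`), binder seat b04 (gen 39), count-neutral own lane «Galois-CM-type classification».  KERNEL ONLY:
theorems; no definition, no named fact, no `sorry`.  `HC_CM` is neither used nor claimed.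

Companion of `CorCM/GaloisOddPrimeShapesQuaternionBad` (`p ≤ 13`): the gen-28/29 `μ₄`-norm pairs for `Q₈ × C_p`, `p = 17, 19, 37, 43`,
converted to balanced sets balanced over `C_p` and lifted (`CorCM/GaloisQuaternionCyclicLiftPredicate`), kill the shapes Q× and QK of
order `2ⁿ·p` for these `p` (`n ≥ 4`; the subgroup `⟨a^{2ⁿ⁻³}, x⟩ × ⟨u⟩ ≅ Q₈ × C_p` through `c`).

* **`exists_simple_degenerate_of_shape_quaternion_of_prime_mem`** — `p ∈ {17, 19, 37, 43}`, shapes Q×/QK ⟹ BAD.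
* **`structure_of_forall_isNondegenerate_of_thirtytwo_dvd_of_prime_mem`** — `[K:ℚ] = 2ⁿ·p`, `n ≥ 5`,
  `p ∈ {3, 5, 7, 11, 13, 17, 19, 37, 43}`, `K` GOOD ⟹ `c` is the unique involution and every Sylow `2`-subgroup is cyclic (shape C(r))
  or generalised quaternion acting through Dic (`a u a⁻¹ = u`, `x u x⁻¹ = u⁻¹`).

## References

* [Shimura1998] G. Shimura, *Abelian Varieties with Complex Multiplication and Modular Functions*, §6.2 Thm. 3, §8.2 Prop. 26, §32.10.
* [Gordon1999HodgeAVSurvey] B. B. Gordon, *A survey of the Hodge conjecture for abelian varieties*, Thm. 6.4, §9.3.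
* [Dodson1984] B. Dodson, *The structure of Galois groups of CM-fields*, Trans. AMS 283 (1984), §3.1.1, §4.1, §5.
* [Rotman1995] J. J. Rotman, *An Introduction to the Theory of Groups*, 4th ed., GTM 148, Thm. 4.12, Thm. 5.46, Thm. 7.41.
-/

noncomputable section

open CategoryTheory CategoryTheory.Limits NumberField
open scoped BigOperators

namespace Summit.HodgeConjecture.CorCM.GaloisModels

open Literature.NumberTheory.ComplexMultiplication
open Literature.AlgebraicGeometry.Motives (AbelianVariety CMType)
open Literature.AlgebraicGeometry.HodgeTheory
open Literature.AlgebraicGeometry.ComplexMultiplication (IsCMTypeRealisation)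
open Literature.AlgebraicGeometry.Pohlmann1968
open Literature.Barriers.HodgeConjecture (divisorClassesSpan)
open Summit.HodgeConjecture.CorCM.GaloisRank

variable {K : Type} [Field K] [NumberField K] [IsCMField K]

/-- **SHAPES Q× AND QK ARE BAD FOR `p ∈ {17, 19, 37, 43}`.**  `u, a, x ∈ Gal(K/ℚ)` with `ord u = p`, `⟨u⟩ ◁ Gal`, `ord a = 2ⁿ⁻¹`
(`n ≥ 4`), `x a = a⁻¹ x`, `x² = a^{2ⁿ⁻²} = c`, `x u x⁻¹ = u` and `a u a⁻¹ = u^{±1}` ⟹ a SIMPLE DEGENERATE CM abelian variety of dimension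
`[K:ℚ]/2` with a rational `(p,p)` class outside the divisor ring on some power. [cite: Shimura1998, §6.2 Thm. 3 and §8.2 Prop. 26]
[cite: Gordon1999HodgeAVSurvey, Thm. 6.4 and §9.3] -/
theorem exists_simple_degenerate_of_shape_quaternion_of_prime_mem [IsGalois ℚ K] {p n : ℕ}
    (hp : p = 17 ∨ p = 19 ∨ p = 37 ∨ p = 43) (hn : 4 ≤ n) {u a x : K ≃ₐ[ℚ] K} (hu : orderOf u = p)
    (hnorm : (Subgroup.zpowers u).Normal) (ha : orderOf a = 2 ^ (n - 1)) (hxa : x * a = a⁻¹ * x)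
    (hxx : x * x = a ^ 2 ^ (n - 2)) (hc : a ^ 2 ^ (n - 2) = (IsCMField.complexConj K).restrictScalars ℚ)
    (hxu : x * u * x⁻¹ = u) (hau : a * u * a⁻¹ = u ∨ a * u * a⁻¹ = u⁻¹) :
    ∃ (Φ : CMType K) (φ₀ : K →+* ℂ) (A : AbelianVariety ℂ) (ι : 𝓞 K →+* End A)
      (θ : K →+* Module.End ℂ (complexBetti A.X 1)),
      IsPrimitive (ℂ ≃+* ℂ) Φ.1 φ₀ ∧ ¬ IsNondegenerate Φ ∧ IsCMTypeRealisation Φ A ι θ ∧ A.IsSimple ∧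
      A.dim = Module.finrank ℚ K / 2 ∧
      ∃ n p : ℕ, ∃ x : complexBetti (⨁ fun _ : Fin n => A).X (2 * p), IsRationalClass x ∧
        IsOfHodgeType (⨁ fun _ : Fin n => A).dim (⨁ fun _ : Fin n => A).X (2 * p) p p x ∧
        x ∉ divisorClassesSpan (⨁ fun _ : Fin n => A).X (⨁ fun _ : Fin n => A).dim p := by
  have h23 : 2 ^ (n - 3) * 2 = 2 ^ (n - 2) := by rw [← pow_succ]; congr 1; omega
  have hA : orderOf (a ^ 2 ^ (n - 3)) = 4 := by
    rw [orderOf_pow_of_dvd (pow_ne_zero _ two_ne_zero) (by rw [ha]; exact pow_dvd_pow 2 (by omega)), ha,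
      Nat.pow_div (by omega) two_pos]
    rw [show n - 1 - (n - 3) = 2 by omega]
    norm_num
  have hX : x * x = (a ^ 2 ^ (n - 3)) ^ 2 := by rw [hxx, ← pow_mul, h23]
  have hXA : x * a ^ 2 ^ (n - 3) * x⁻¹ = (a ^ 2 ^ (n - 3))⁻¹ := conj_pow_eq_inv_of_mul_eq hxa _
  have hc' : (a ^ 2 ^ (n - 3)) ^ 2 = (IsCMField.complexConj K).restrictScalars ℚ := by rw [← pow_mul, h23, hc]
  have hAu : a ^ 2 ^ (n - 3) * u = u * a ^ 2 ^ (n - 3) := by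
    rcases hau with hau | hau
    · exact ((show Commute a u from mul_comm_of_conj_eq hau).pow_left _).eq
    · have h24 : 2 ^ (n - 3) = 2 * 2 ^ (n - 4) := by rw [← pow_succ']; congr 1; omega
      rw [h24]
      exact pow_two_mul_comm_of_conj_eq_inv hau _
  have hXu : x * u = u * x := mul_comm_of_conj_eq hxu
  rcases hp with rfl | rfl | rfl | rfl
  · exact exists_simple_degenerate_of_quaternionEight_cyclic17_subgroup hA hX hXA hc' hu hAu hXu hnorm
  · exact exists_simple_degenerate_of_quaternionEight_cyclic19_subgroup hA hX hXA hc' hu hAu hXu hnorm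
  · exact exists_simple_degenerate_of_quaternionEight_cyclic37_subgroup hA hX hXA hc' hu hAu hXu hnorm
  · exact exists_simple_degenerate_of_quaternionEight_cyclic43_subgroup hA hX hXA hc' hu hAu hXu hnorm

/-- **GOOD GALOIS CM FIELDS OF DEGREE `2ⁿ·p`, `p ∈ {3,5,7,11,13,17,19,37,43}`, `n ≥ 5`: SHAPE C(r) OR Dic** — complex conjugation is
the unique involution and every Sylow `2`-subgroup `S` (order `2ⁿ`) is EITHER cyclic `⟨x⟩` with `Gal = ⟨u⟩⟨x⟩`, `x u x⁻¹ = uʳ`, OR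
generalised quaternion `⟨a, x⟩` with `a u a⁻¹ = u`, `x u x⁻¹ = u⁻¹`. [cite: Shimura1998, §8.2 Prop. 26 and §32.10]
[cite: Dodson1984, §3.1.1, §4.1 and §5] [cite: Rotman1995, Thm. 4.12, Thm. 5.46 and Thm. 7.41] -/
theorem structure_of_forall_isNondegenerate_of_thirtytwo_dvd_of_prime_mem [IsGalois ℚ K] {n p : ℕ}
    (hp : p = 3 ∨ p = 5 ∨ p = 7 ∨ p = 11 ∨ p = 13 ∨ p = 17 ∨ p = 19 ∨ p = 37 ∨ p = 43)
    (hdeg : Module.finrank ℚ K = 2 ^ n * p) (hn : 5 ≤ n)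
    (hgood : ∀ (Φ : CMType K) (φ : K →+* ℂ), IsPrimitive (ℂ ≃+* ℂ) Φ.1 φ → IsNondegenerate Φ) [Fact (Nat.Prime 2)] :
    (∀ σ : K ≃ₐ[ℚ] K, σ * σ = 1 → σ ≠ 1 → σ = (IsCMField.complexConj K).restrictScalars ℚ) ∧
      ∀ S : Sylow 2 (K ≃ₐ[ℚ] K), Nat.card (S : Subgroup (K ≃ₐ[ℚ] K)) = 2 ^ n ∧
        ((∃ u x : K ≃ₐ[ℚ] K, orderOf u = p ∧ (Subgroup.zpowers u).Normal ∧ orderOf x = 2 ^ n ∧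
            Subgroup.zpowers x = (S : Subgroup (K ≃ₐ[ℚ] K)) ∧ (∀ g : K ≃ₐ[ℚ] K, ∃ j i : ℕ, g = u ^ j * x ^ i) ∧
            ∃ r : ℕ, x * u * x⁻¹ = u ^ r) ∨
         (∃ u a x : K ≃ₐ[ℚ] K, orderOf u = p ∧ (Subgroup.zpowers u).Normal ∧ orderOf a = 2 ^ (n - 1) ∧
            a ∈ (S : Subgroup (K ≃ₐ[ℚ] K)) ∧ x ∈ (S : Subgroup (K ≃ₐ[ℚ] K)) ∧ x ∉ Subgroup.zpowers a ∧ x * a = a⁻¹ * x ∧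
            x * x = a ^ 2 ^ (n - 2) ∧ (∀ g : K ≃ₐ[ℚ] K, ∃ j i : ℕ, g = u ^ j * a ^ i ∨ g = u ^ j * (x * a ^ i)) ∧
            a * u * a⁻¹ = u ∧ x * u * x⁻¹ = u⁻¹)) := by
  rcases hp with h | h | h | h | h | hp'
  iterate 5
    exact structure_of_forall_isNondegenerate_of_thirtytwo_dvd_of_prime_le_thirteen (by omega) hdeg hn hgood
  -- `p ∈ {17, 19, 37, 43}`
  have hpodd : Odd p := by rcases hp' with rfl | rfl | rfl | rfl <;> decide
  have hp1 : p ≠ 1 := by rcases hp' with rfl | rfl | rfl | rfl <;> decide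
  rcases structure_of_forall_isNondegenerate_of_thirtytwo_dvd hdeg hpodd hn hgood with ⟨hM1, -⟩ | ⟨-, hinv, hS⟩
  · exact absurd hM1 hp1
  refine ⟨hinv, fun S => ?_⟩
  obtain ⟨hcardS, hshape⟩ := hS S
  refine ⟨hcardS, ?_⟩
  rcases hshape with hcyc | ⟨u, a, x, hu, hnorm, ha, haS, hxS, hxa', hxa, hxx, hgen, hshapes⟩
  · exact Or.inl hcyc
  right
  have hc : a ^ 2 ^ (n - 2) = (IsCMField.complexConj K).restrictScalars ℚ := by
    refine hinv _ ?_ ?_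
    · rw [← pow_add, ← two_mul, ← pow_succ', show n - 2 + 1 = n - 1 by omega, ← ha, pow_orderOf_eq_one]
    · exact pow_ne_one_of_lt_orderOf (pow_ne_zero _ two_ne_zero) (by rw [ha]; exact Nat.pow_lt_pow_right (by norm_num) (by omega))
  have hbad : (a * u * a⁻¹ = u ∨ a * u * a⁻¹ = u⁻¹) → x * u * x⁻¹ = u → False := fun hau hxu => by
    obtain ⟨Φ, φ₀, -, -, -, hprim, hdeg', -⟩ :=
      exists_simple_degenerate_of_shape_quaternion_of_prime_mem hp' (by omega) hu hnorm ha hxa hxx hc hxu hau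
    exact hdeg' (hgood Φ φ₀ hprim)
  rcases hshapes with ⟨hau, hxu⟩ | hdic | ⟨hau, hxu⟩
  · exact (hbad (Or.inl hau) hxu).elim
  · exact ⟨u, a, x, hu, hnorm, ha, haS, hxS, hxa', hxa, hxx, hgen, hdic⟩
  · exact (hbad (Or.inr hau) hxu).elim

end Summit.HodgeConjecture.CorCM.GaloisModels

end
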